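import Summits.CriticalPhenomena.PercolationContinuityZ3.Theorems.PercGamblersRuinVerticalGamblersRuinStubPathFunctionalBasics

/-!
# Route `PercGamblersRuin`, crux `VerticalGamblersRuin` (stmt-CriticalPhenomena-10642):
# stub `stub_pathReversal` — reversibility of the degree-biased annealed path law

Helper file for the stub `stub_pathReversal` of the line `registered` (skeleton rev 8, the
Lyons–Zheng exit-time bound) of the crux `PercGamblersRuin.VerticalGamblersRuin`.

Setting.  Bond configurations `ω` on `ℤ³` under `P = P_{p_c}`; `N_ω(x)` is the set of lattice
neighbours `y ∼ x` with `s(x, y)` open in `ω`, `deg_ω(0) = #N_ω(0)`;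
`ω - v = BondConfig.relabel (sym2Equiv (Site.shift (-v))) ω` is the configuration seen from `v`.
The PATH FUNCTIONAL `E ω T x G = E^ω_x[G [X_0, …, X_T]]` of the simple random walk on the open
lattice edges of `ω` (a sub-probability, `0/0 = 0`) enters as a universally quantified `E` pinned
by the first-step recursion `hE0 : E ω 0 x G = G [x]`,
`hEs : E ω (T+1) x G = (∑_{y ∈ N_ω(x)} E ω T y (l ↦ G (x :: l))) / #N_ω(x)`.

Statement proved (exact registered signature): for every `T` and every functional `G(ω, l)`,
measurable in `ω` for each `l` and `[0, 1]`-valued,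
`∫_{0↔∞} deg_ω(0) · E ω T 0 (G ω) dP = ∫_{0↔∞} deg_ω(0) · E ω T 0 (l ↦ G (ω - x_T) (rev l - x_T)) dP`
with `x_T = l.getLastD 0` and `rev l - x_T = (l.reverse).map (· - x_T)`: the degree-biased annealed
`T`-step path law is REVERSIBLE under `(ω, X_0..X_T) ↦ (ω - X_T, X_T - X_T, …, X_0 - X_T)`.

Proof: induction on `T` generalizing `G`.  Ingredients (inductions on `T` from `hE0`/`hEs`):
(a) LAST-STEP RECURSION `E ω (T+1) x G = E ω T x (l ↦ (∑_{y ∈ N_ω(last l)} G (l ++ [y])) / #N_ω(last l))`;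
(b) SHIFT COVARIANCE `E ω T z Φ = E (ω - v) T (z - v) (l ↦ Φ (l + v))`; (c) the ONE-STEP
TRANSLATION identity `∫_{0↔∞} ∑_{z ∈ N_ω(0)} F(ω - z, z) dP = ∫_{0↔∞} ∑_{y ∈ N_ω(0)} F(ω, -y) dP`
(translation invariance of `P_{p_c}` + "an open edge joins the clusters of its endpoints": the
landed `StubStationarity.setIntegral_ite_relabel`, summed over `z ∼ 0`, reindexed by `y ↦ -y`);
(d) linearity and support of `E`.  Step: (a) + the induction hypothesis for
`G̃ ω l = E ω 1 (last l) (m ↦ G ω (l ++ m.tail))` turn the left side into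
`∫ ∑_{z ∈ N_ω(0)} E ω T 0 (l ↦ G (ω - x_T) ((rev l - x_T) ++ [z - x_T]))`; `hEs` and (b) turn the
right side into `∫ ∑_{z ∈ N_ω(0)} F(ω - z, z)` with
`F ω' z = E ω' T 0 (l ↦ G (ω' - x_T) ((rev l - x_T) ++ [-z - x_T]))`; (c) identifies the two.

## References

* R. Lyons, Y. Peres, *Probability on Trees and Networks*, Cambridge University Press (2016),
  §2.1 (path expectations and reversibility of network random walks).
* A. De Masi, P. A. Ferrari, S. Goldstein, W. D. Wick, *An invariance principle for reversible
  Markov processes. Applications to random motions in random environments*, J. Statist. Phys.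
  55 (1989), 787–855, §4 (the environment seen from the walker on the cluster).
* G. Grimmett, *Percolation*, 2nd ed., Springer (1999), §1.6 (translation invariance of `P_p`).
-/

noncomputable section

namespace Summit.CriticalPhenomena.PercolationContinuityZ3.Theorems.VerticalGamblersRuin

open MeasureTheory Filter Topology
open Literature.Probability.Percolation Literature.Probability.LatticeModels
open scoped Classical

namespace StubPathReversal

/-! ### The path functional pinned by its first-step recursion: finite sums, last step -/

section Abstract

variable {V : Type*} {N : V → Finset V} {F : ℕ → V → (List V → ℝ) → ℝ}

/-- **Finite sums**: a path functional `F` pinned by the first-step recursion commutes with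
finite sums of functionals, `F T x (∑_{i ∈ s} g i) = ∑_{i ∈ s} F T x (g i)`. -/
theorem finset_sum (hF0 : ∀ x G, F 0 x G = G [x])
    (hFs : ∀ T x G, F (T + 1) x G = (∑ y ∈ N x, F T y (fun l => G (x :: l))) / ((N x).card : ℝ))
    {ι : Type*} (s : Finset ι) (T : ℕ) :
    ∀ (x : V) (g : ι → List V → ℝ), F T x (fun l => ∑ i ∈ s, g i l) = ∑ i ∈ s, F T x (g i) := by
  induction T with
  | zero =>
    intro x g
    rw [hF0]
    exact Finset.sum_congr rfl fun i _ => (hF0 x (g i)).symm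
  | succ T ih =>
    intro x g
    simp only [hFs]
    rw [← Finset.sum_div, Finset.sum_comm]
    exact congrArg (· / _) (Finset.sum_congr rfl fun y _ => ih y fun i l => g i (x :: l))

/-- **Division by a constant**: `F T x (l ↦ G l / c) = F T x G / c` (homogeneity). -/
theorem div_const (hF0 : ∀ x G, F 0 x G = G [x])
    (hFs : ∀ T x G, F (T + 1) x G = (∑ y ∈ N x, F T y (fun l => G (x :: l))) / ((N x).card : ℝ))
    (T : ℕ) (x : V) (G : List V → ℝ) (c : ℝ) : F T x (fun l => G l / c) = F T x G / c := by
  simp only [div_eq_inv_mul]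
  exact StubPathFunctionalBasics.smul hF0 hFs T x c⁻¹ G

/-- The last element of a nonempty list does not depend on the default value. -/
theorem getLastD_eq_getLastD {α : Type*} {l : List α} (h : l ≠ []) (a b : α) :
    l.getLastD a = l.getLastD b := by
  obtain ⟨c, l', rfl⟩ := List.exists_cons_of_ne_nil h
  rw [List.getLastD_cons, List.getLastD_cons]

/-- **Last-step recursion**: conditioning on the last step instead of the first,
`F (T+1) x G = F T x (l ↦ (∑_{y ∈ N (last l)} G (l ++ [y])) / #N (last l))` (induction on `T`; the
step uses that `F T y` only evaluates nonempty lists, `StubPathFunctionalBasics.congr_path`). -/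
theorem succ_eq_last (hF0 : ∀ x G, F 0 x G = G [x])
    (hFs : ∀ T x G, F (T + 1) x G = (∑ y ∈ N x, F T y (fun l => G (x :: l))) / ((N x).card : ℝ))
    (d : V) (T : ℕ) : ∀ (x : V) (G : List V → ℝ), F (T + 1) x G =
      F T x (fun l => (∑ y ∈ N (l.getLastD d), G (l ++ [y])) / ((N (l.getLastD d)).card : ℝ)) := by
  induction T with
  | zero =>
    intro x G
    rw [hFs, hF0, List.getLastD_cons, List.getLastD_nil]
    simp only [hF0, List.singleton_append]
  | succ T ih =>
    intro x G
    rw [hFs, hFs]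
    refine congrArg (· / _) (Finset.sum_congr rfl fun y _ => ?_)
    rw [ih y]
    refine StubPathFunctionalBasics.congr_path (v₀ := d) hF0 hFs T y fun l hl _ => ?_
    rw [List.getLastD_cons, getLastD_eq_getLastD (List.ne_nil_of_length_eq_add_one hl) x d]
    rfl

/-- `#s · ((∑_{i ∈ s} f i) / #s) = ∑_{i ∈ s} f i` (both sides vanish for `s = ∅`). -/
theorem card_mul_sum_div {ι : Type*} (s : Finset ι) (f : ι → ℝ) :
    (s.card : ℝ) * ((∑ i ∈ s, f i) / (s.card : ℝ)) = ∑ i ∈ s, f i := by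
  rcases Finset.eq_empty_or_nonempty s with rfl | hs
  · simp
  · exact mul_div_cancel₀ _ (Nat.cast_ne_zero.2 hs.card_pos.ne')

end Abstract

/-! ### Lattice bookkeeping: open neighbours seen from a site, list identities -/

/-- The open lattice neighbours of `z - v` in `ω - v` are those of `z` in `ω` translated by `-v`
(`s(a, b) ∈ ω - v ↔ s(a + v, b + v) ∈ ω` and translation invariance of adjacency). -/
theorem filter_sub_eq_map (ω : BondConfig (Site 3)) (v z : Site 3) :
    ((zdGraph 3).neighborFinset (z - v)).filter
        (fun y => s(z - v, y) ∈ BondConfig.relabel (sym2Equiv (Site.shift (-v))) ω) =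
      (((zdGraph 3).neighborFinset z).filter (fun y => s(z, y) ∈ ω)).map
        (Equiv.subRight v).toEmbedding := by
  ext y
  have hadj : (zdGraph 3).Adj (z - v + v) (y + v) ↔ (zdGraph 3).Adj (z - v) y :=
    zdGraph_adj_shift_iff v (z - v) y
  rw [sub_add_cancel] at hadj
  rw [Finset.mem_map_equiv, Equiv.subRight_symm_apply]
  simp only [Finset.mem_filter, SimpleGraph.mem_neighborFinset,
    StubStationarity.mk_mem_relabel_shift_neg_iff, sub_add_cancel, hadj]

/-- The last element of the reversal of a nonempty list, mapped, is the image of its head. -/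
theorem getLastD_map_reverse {α β : Type*} {l : List α} (h : l ≠ []) (f : α → β) (b : β) (a : α) :
    ((l.reverse).map f).getLastD b = f (l.getD 0 a) := by
  obtain ⟨c, l', rfl⟩ := List.exists_cons_of_ne_nil h
  rw [List.reverse_cons, List.map_append, List.map_cons, List.map_nil, List.getLastD_concat,
    List.getD_cons_zero]

/-- The last element of a nonempty list of sites translated by `z`. -/
theorem getLastD_map_add {l : List (Site 3)} (h : l ≠ []) (z : Site 3) :
    (l.map (· + z)).getLastD 0 = l.getLastD 0 + z := by
  obtain ⟨c, l', rfl⟩ := List.exists_cons_of_ne_nil h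
  rw [List.map_cons, List.getLastD_cons, List.getLastD_cons]
  exact List.getLastD_map (f := (· + z))

/-! ### The one-step translation identity -/

/-- **One-step translation, general form.**  For `F(ω, z)` measurable and `[0, 1]`-valued in `ω`
for each `z`: `∫_{0↔∞} ∑_{z ∈ N_ω(0)} F(ω - z, z) dP = ∫_{0↔∞} ∑_{y ∈ N_ω(0)} F(ω, -y) dP`
(`StubStationarity.setIntegral_ite_relabel` for each lattice neighbour `z` of `0` with `f := F(·, z)`,
summed over `z ∼ 0`, and the reindexing `y = -z` of the lattice neighbours of `0`). -/
theorem setIntegral_sum_relabel (Fz : BondConfig (Site 3) → Site 3 → ℝ)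
    (hF : ∀ z, Measurable fun ω => Fz ω z) (hb : ∀ ω z, 0 ≤ Fz ω z ∧ Fz ω z ≤ 1) :
    ∫ ω in percolatesAt (0 : Site 3),
        (∑ z ∈ ((zdGraph 3).neighborFinset (0 : Site 3)).filter (fun y => s((0 : Site 3), y) ∈ ω),
          Fz (BondConfig.relabel (sym2Equiv (Site.shift (-z))) ω) z)
        ∂(bondPercolation (zdGraph 3) (criticalProbI 3)) =
      ∫ ω in percolatesAt (0 : Site 3),
        (∑ y ∈ ((zdGraph 3).neighborFinset (0 : Site 3)).filter (fun y => s((0 : Site 3), y) ∈ ω),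
          Fz ω (-y)) ∂(bondPercolation (zdGraph 3) (criticalProbI 3)) := by
  have hI1 : ∀ z ∈ (zdGraph 3).neighborFinset (0 : Site 3),
      Integrable (fun ω : BondConfig (Site 3) => if s((0 : Site 3), z) ∈ ω then
        Fz (BondConfig.relabel (sym2Equiv (Site.shift (-z))) ω) z else 0)
        ((bondPercolation (zdGraph 3) (criticalProbI 3)).restrict (percolatesAt (0 : Site 3))) :=
    fun z _ => StubStationarity.integrable_of_bounds (StubStationarity.measurable_ite_relabel (hF z) z)
      (fun ω => by split_ifs <;> [exact hb _ _; exact ⟨le_rfl, zero_le_one⟩]) _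
  have hI2 : ∀ y ∈ (zdGraph 3).neighborFinset (0 : Site 3),
      Integrable (fun ω : BondConfig (Site 3) => if s((0 : Site 3), y) ∈ ω then Fz ω (-y) else 0)
        ((bondPercolation (zdGraph 3) (criticalProbI 3)).restrict (percolatesAt (0 : Site 3))) :=
    fun y _ => StubStationarity.integrable_of_bounds (Measurable.ite (measurableSet_mem
      (s((0 : Site 3), y) : Sym2 (Site 3))) (hF (-y)) measurable_const)
        (fun ω => by split_ifs <;> [exact hb _ _; exact ⟨le_rfl, zero_le_one⟩]) _
  simp only [Finset.sum_filter]
  rw [integral_finsetSum _ hI1, integral_finsetSum _ hI2]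
  refine Finset.sum_equiv (Equiv.neg (Site 3)) (fun z => ?_) (fun z hz => ?_)
  · rw [SimpleGraph.mem_neighborFinset, SimpleGraph.mem_neighborFinset, Equiv.neg_apply,
      ← StubStationarity.zdGraph_adj_neg_zero_iff z]
    exact (zdGraph 3).adj_comm _ _
  · rw [StubStationarity.setIntegral_ite_relabel (fun ω => Fz ω z)
      ((SimpleGraph.mem_neighborFinset _ _ _).1 hz), Equiv.neg_apply, neg_neg, Sym2.eq_swap]

/-! ### The path functional on the lattice: measurability, bounds, shift covariance -/

section PathFunctional

variable {E : BondConfig (Site 3) → ℕ → Site 3 → (List (Site 3) → ℝ) → ℝ}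
  (hE0 : ∀ ω (x : Site 3) (G : List (Site 3) → ℝ), E ω 0 x G = G [x])
  (hEs : ∀ ω (T : ℕ) (x : Site 3) (G : List (Site 3) → ℝ), E ω (T + 1) x G =
    (∑ y ∈ ((zdGraph 3).neighborFinset x).filter (fun y => s(x, y) ∈ ω),
        E ω T y (fun l => G (x :: l))) /
      ((((zdGraph 3).neighborFinset x).filter (fun y => s(x, y) ∈ ω)).card : ℝ))
include hE0 hEs

/-- **Measurability**: for a functional `G(ω, l)` measurable in `ω` for each `l`, the quenched
expectation `ω ↦ E ω T x (G ω)` is measurable (induction on `T`: `hEs` is a finite sum over the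
lattice neighbours `y ∼ x` of `1_{s(x,y) ∈ ω} · E ω T y (…)`, divided by the measurable degree). -/
theorem measurable_E (T : ℕ) :
    ∀ (x : Site 3) {G : BondConfig (Site 3) → List (Site 3) → ℝ},
      (∀ l, Measurable fun ω => G ω l) → Measurable fun ω => E ω T x (G ω) := by
  induction T with
  | zero =>
    intro x G hG
    simp only [hE0]
    exact hG [x]
  | succ T ih =>
    intro x G hG
    simp only [hEs, Finset.sum_filter]
    refine Measurable.div (Finset.measurable_sum _ fun y _ => ?_) (DeterministicTime.measurable_deg x)
    exact Measurable.ite (measurableSet_mem (s(x, y) : Sym2 (Site 3)))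
      (ih y (G := fun ω l => G ω (x :: l)) fun l => hG (x :: l)) measurable_const

/-- **Bounds**: `E ω T x G ∈ [0, 1]` for `[0, 1]`-valued `G` (nonnegativity, monotonicity and
mass at most one of the path functional). -/
theorem E_mem_Icc (ω : BondConfig (Site 3)) (T : ℕ) (x : Site 3) {G : List (Site 3) → ℝ}
    (hG : ∀ l, 0 ≤ G l ∧ G l ≤ 1) : 0 ≤ E ω T x G ∧ E ω T x G ≤ 1 :=
  ⟨StubPathFunctionalBasics.nonneg (hE0 ω) (hEs ω) T x fun l => (hG l).1,
    (StubForwardKolmogorov.mono (hE0 ω) (hEs ω) T x fun l => (hG l).2).trans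
      (StubPathFunctionalBasics.mass_le_one (hE0 ω) (hEs ω) T x)⟩

/-- **Shift covariance**: `E ω T x Φ = E (ω - v) T (x - v) (l ↦ Φ (l + v))` (induction on `T`:
the open neighbours of `x - v` in `ω - v` are those of `x` in `ω` translated by `-v`). -/
theorem shift_cov (ω : BondConfig (Site 3)) (v : Site 3) (T : ℕ) :
    ∀ (x : Site 3) (Φ : List (Site 3) → ℝ), E ω T x Φ =
      E (BondConfig.relabel (sym2Equiv (Site.shift (-v))) ω) T (x - v)
        (fun l => Φ (l.map (· + v))) := by
  induction T with
  | zero =>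
    intro x Φ
    rw [hE0, hE0, List.map_cons, List.map_nil, sub_add_cancel]
  | succ T ih =>
    intro x Φ
    rw [hEs, hEs, filter_sub_eq_map, Finset.card_map, Finset.sum_map]
    refine congrArg₂ (· / ·) (Finset.sum_congr rfl fun y _ => ?_) rfl
    rw [ih y]
    simp only [Equiv.coe_toEmbedding, Equiv.subRight_apply, List.map_cons, sub_add_cancel]

/-! ### The two sides of the induction step -/

/-- **Left side, after the last-step recursion and the induction hypothesis.**  For
`Gt ω l = E ω 1 (last l) (m ↦ G ω (l ++ m.tail)) = (∑_{y ∈ N_ω(last l)} G ω (l ++ [y])) / #N_ω(last l)`: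
`deg_ω(0) · E ω T 0 (l ↦ Gt (ω - x_T) (rev l - x_T)) = ∑_{z ∈ N_ω(0)} E ω T 0 (l ↦ G (ω - x_T) ((rev l - x_T)
++ [z - x_T]))` (linearity; on the support `last (rev l - x_T) = -x_T`, `N_{ω - x_T}(-x_T) = N_ω(0) - x_T`). -/
theorem card_mul_E_rev_last (G Gt : BondConfig (Site 3) → List (Site 3) → ℝ)
    (hGt : Gt = fun ω l => E ω (0 + 1) (l.getLastD 0) fun m => G ω (l ++ m.tail))
    (ω : BondConfig (Site 3)) (T : ℕ) :
    ((((zdGraph 3).neighborFinset (0 : Site 3)).filter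
        (fun y => s((0 : Site 3), y) ∈ ω)).card : ℝ) *
      E ω T 0 (fun l => Gt (BondConfig.relabel (sym2Equiv (Site.shift (-(l.getLastD 0)))) ω)
        ((l.reverse).map (fun z => z - l.getLastD 0))) =
    ∑ w ∈ ((zdGraph 3).neighborFinset (0 : Site 3)).filter (fun y => s((0 : Site 3), y) ∈ ω),
      E ω T 0 (fun l => G (BondConfig.relabel (sym2Equiv (Site.shift (-(l.getLastD 0)))) ω)
        ((l.reverse).map (fun z => z - l.getLastD 0) ++ [w - l.getLastD 0])) := by
  rw [← card_mul_sum_div, ← finset_sum (hE0 ω) (hEs ω), ← div_const (hE0 ω) (hEs ω)]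
  refine congrArg₂ (· * ·) rfl (StubPathFunctionalBasics.congr_path (v₀ := (0 : Site 3)) (hE0 ω)
    (hEs ω) T 0 fun l hl h0 => ?_)
  simp only [hGt, hEs, hE0, List.tail_cons]
  rw [getLastD_map_reverse (List.ne_nil_of_length_eq_add_one hl) _ 0 0, h0, filter_sub_eq_map,
    Finset.card_map, Finset.sum_map]
  rfl

/-- **Right side, after the first-step recursion and shift covariance.**
`deg_ω(0) · E ω (T+1) 0 (l ↦ G (ω - x_{T+1}) (rev l - x_{T+1})) = ∑_{z ∈ N_ω(0)} E (ω - z) T 0 (l ↦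
G ((ω - z) - x_T) ((rev l - x_T) ++ [-z - x_T]))` (`hEs`, the degree cancels, shift covariance with
`v := z`; on the support `last (0 :: (l + z)) = x_T + z`, `ω - (x_T + z) = (ω - z) - x_T`). -/
theorem card_mul_E_succ_rev (G : BondConfig (Site 3) → List (Site 3) → ℝ)
    (ω : BondConfig (Site 3)) (T : ℕ) :
    ((((zdGraph 3).neighborFinset (0 : Site 3)).filter
        (fun y => s((0 : Site 3), y) ∈ ω)).card : ℝ) *
      E ω (T + 1) 0 (fun l => G (BondConfig.relabel (sym2Equiv (Site.shift (-(l.getLastD 0)))) ω)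
        ((l.reverse).map (fun z => z - l.getLastD 0))) =
    ∑ w ∈ ((zdGraph 3).neighborFinset (0 : Site 3)).filter (fun y => s((0 : Site 3), y) ∈ ω),
      E (BondConfig.relabel (sym2Equiv (Site.shift (-w))) ω) T 0 (fun l =>
        G (BondConfig.relabel (sym2Equiv (Site.shift (-(l.getLastD 0))))
            (BondConfig.relabel (sym2Equiv (Site.shift (-w))) ω))
          ((l.reverse).map (fun z => z - l.getLastD 0) ++ [-w - l.getLastD 0])) := by
  rw [hEs, card_mul_sum_div]
  refine Finset.sum_congr rfl fun w _ => ?_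
  rw [shift_cov hE0 hEs ω w T w, sub_self]
  refine StubPathFunctionalBasics.congr_path (v₀ := (0 : Site 3)) (hE0 _) (hEs _) T 0
    fun l hl _ => ?_
  rw [List.getLastD_cons, getLastD_map_add (List.ne_nil_of_length_eq_add_one hl), List.reverse_cons,
    List.map_append, List.map_cons, List.map_nil, ← List.map_reverse, List.map_map]
  simp only [Function.comp_def, add_sub_add_right_eq_sub, zero_sub, neg_add_rev, ← sub_eq_add_neg,
    StubStationarity.relabel_shift_neg_relabel_shift_neg]

/-- **The translation step of the induction**: `setIntegral_sum_relabel` for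
`F ω' z = E ω' T 0 (l ↦ G (ω' - x_T) ((rev l - x_T) ++ [-z - x_T]))`. -/
theorem setIntegral_sum_seen_from (T : ℕ) (G : BondConfig (Site 3) → List (Site 3) → ℝ)
    (hGm : ∀ l, Measurable fun ω => G ω l) (hGb : ∀ ω l, 0 ≤ G ω l ∧ G ω l ≤ 1) :
    ∫ ω in percolatesAt (0 : Site 3),
        (∑ w ∈ ((zdGraph 3).neighborFinset (0 : Site 3)).filter (fun y => s((0 : Site 3), y) ∈ ω),
          E (BondConfig.relabel (sym2Equiv (Site.shift (-w))) ω) T 0 (fun l =>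
            G (BondConfig.relabel (sym2Equiv (Site.shift (-(l.getLastD 0))))
                (BondConfig.relabel (sym2Equiv (Site.shift (-w))) ω))
              ((l.reverse).map (fun z => z - l.getLastD 0) ++ [-w - l.getLastD 0])))
        ∂(bondPercolation (zdGraph 3) (criticalProbI 3)) =
      ∫ ω in percolatesAt (0 : Site 3),
        (∑ w ∈ ((zdGraph 3).neighborFinset (0 : Site 3)).filter (fun y => s((0 : Site 3), y) ∈ ω),
          E ω T 0 (fun l => G (BondConfig.relabel (sym2Equiv (Site.shift (-(l.getLastD 0)))) ω)
            ((l.reverse).map (fun z => z - l.getLastD 0) ++ [w - l.getLastD 0])))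
        ∂(bondPercolation (zdGraph 3) (criticalProbI 3)) := by
  have h := setIntegral_sum_relabel
    (fun ω w => E ω T 0 (fun l =>
      G (BondConfig.relabel (sym2Equiv (Site.shift (-(l.getLastD 0)))) ω)
        ((l.reverse).map (fun z => z - l.getLastD 0) ++ [-w - l.getLastD 0])))
    (fun w => measurable_E hE0 hEs T 0 fun l =>
      (hGm _).comp (BondConfig.relabel (sym2Equiv (Site.shift (-(l.getLastD 0))))).measurable)
    (fun ω w => E_mem_Icc hE0 hEs ω T 0 fun l => hGb _ _)
  simpa only [neg_neg] using h

/-! ### Induction on the number of steps -/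

/-- **Reversibility of the degree-biased annealed path law, all times.**  For every `T` and every
functional `G(ω, l)` measurable in `ω` for each `l` and `[0, 1]`-valued:
`∫_{0↔∞} deg_ω(0) · E ω T 0 (G ω) dP = ∫_{0↔∞} deg_ω(0) · E ω T 0 (l ↦ G (ω - x_T) (rev l - x_T)) dP`.
Induction on `T` generalizing `G` (induction hypothesis for `G̃ ω l = E ω 1 (last l) (m ↦ G ω (l ++ m.tail))`,
`card_mul_E_rev_last`, `card_mul_E_succ_rev`, `setIntegral_sum_seen_from`). -/
theorem setIntegral_card_mul_E_rev (T : ℕ) :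
    ∀ G : BondConfig (Site 3) → List (Site 3) → ℝ,
      (∀ l, Measurable fun ω => G ω l) → (∀ ω l, 0 ≤ G ω l ∧ G ω l ≤ 1) →
      ∫ ω in percolatesAt (0 : Site 3),
          ((((zdGraph 3).neighborFinset (0 : Site 3)).filter
              (fun y => s((0 : Site 3), y) ∈ ω)).card : ℝ) * E ω T 0 (G ω)
          ∂(bondPercolation (zdGraph 3) (criticalProbI 3)) =
        ∫ ω in percolatesAt (0 : Site 3),
          ((((zdGraph 3).neighborFinset (0 : Site 3)).filter
              (fun y => s((0 : Site 3), y) ∈ ω)).card : ℝ) *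
            E ω T 0 (fun l => G (BondConfig.relabel (sym2Equiv (Site.shift (-(l.getLastD 0)))) ω)
              ((l.reverse).map (fun z => z - l.getLastD 0)))
          ∂(bondPercolation (zdGraph 3) (criticalProbI 3)) := by
  induction T with
  | zero =>
    intro G hGm hGb
    simp only [hE0, List.getLastD_cons, List.getLastD_nil, List.reverse_cons, List.reverse_nil,
      List.nil_append, List.map_cons, List.map_nil, sub_zero,
      StubStationarity.relabel_shift_neg_zero]
  | succ T ih =>
    intro G hGm hGb
    obtain ⟨Gt, hGt⟩ : ∃ Gt : BondConfig (Site 3) → List (Site 3) → ℝ,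
        Gt = fun ω l => E ω (0 + 1) (l.getLastD 0) fun m => G ω (l ++ m.tail) := ⟨_, rfl⟩
    have hGt_meas : ∀ l, Measurable fun ω => Gt ω l := fun l => by
      rw [hGt]
      exact measurable_E hE0 hEs (0 + 1) _ fun m => hGm _
    have hGt_b : ∀ ω l, 0 ≤ Gt ω l ∧ Gt ω l ≤ 1 := fun ω l => by
      rw [hGt]
      exact E_mem_Icc hE0 hEs ω (0 + 1) _ fun m => hGb _ _
    have hL1 : ∀ ω, E ω (T + 1) 0 (G ω) = E ω T 0 (Gt ω) := fun ω => by
      rw [succ_eq_last (hE0 ω) (hEs ω) (0 : Site 3) T 0 (G ω)]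
      simp only [hGt, hEs, hE0, List.tail_cons]
    simp only [hL1]
    rw [ih Gt hGt_meas hGt_b]
    simp only [card_mul_E_rev_last hE0 hEs G Gt hGt, card_mul_E_succ_rev hE0 hEs G]
    exact (setIntegral_sum_seen_from hE0 hEs T G hGm hGb).symm

end PathFunctional

end StubPathReversal

open StubPathReversal in
/-- **Stub `stub_pathReversal`** of the crux `VerticalGamblersRuin` (line `registered`, rev 8; exact
registered signature): **reversibility of the degree-biased annealed `T`-step path law.**  With
`E ω T x G = E^ω_x[G [X_0, …, X_T]]` the path functional of the SRW on the open lattice edges of `ω`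
(pinned by its first-step recursion `hE0`/`hEs`) and `deg_ω(0) = #N_ω(0)`: for every `T` and
every functional `G(ω, l)` of environment and path, measurable in `ω` for each `l` and
`[0, 1]`-valued, `∫_{0↔∞} deg·E ω T 0 (G ω) dP_{p_c} = ∫_{0↔∞} deg·E ω T 0 (l ↦ G (ω - x_T)
(rev l - x_T)) dP_{p_c}`, where `x_T = l.getLastD 0`, `ω - v = BondConfig.relabel (sym2Equiv
(Site.shift (-v))) ω` and `rev l - x_T = (l.reverse).map (· - x_T)`.  Proof:
`StubPathReversal.setIntegral_card_mul_E_rev` (induction on `T`: last-step recursion, shift covariance,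
translation invariance of `P_{p_c}` + "an open edge joins the clusters of its endpoints", linearity). -/
theorem stub_pathReversal :
    ∀ E : BondConfig (Site 3) → ℕ → Site 3 → (List (Site 3) → ℝ) → ℝ,
      (∀ ω (x : Site 3) (G : List (Site 3) → ℝ), E ω 0 x G = G [x]) →
      (∀ ω (T : ℕ) (x : Site 3) (G : List (Site 3) → ℝ), E ω (T + 1) x G =
        (∑ y ∈ ((zdGraph 3).neighborFinset x).filter (fun y => s(x, y) ∈ ω),
            E ω T y (fun l => G (x :: l))) /
          ((((zdGraph 3).neighborFinset x).filter (fun y => s(x, y) ∈ ω)).card : ℝ)) →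
    ∀ (T : ℕ) (G : BondConfig (Site 3) → List (Site 3) → ℝ),
      (∀ l, Measurable fun ω => G ω l) → (∀ ω l, 0 ≤ G ω l ∧ G ω l ≤ 1) →
      ∫ ω in percolatesAt (0 : Site 3),
          ((((zdGraph 3).neighborFinset (0 : Site 3)).filter
              (fun y => s((0 : Site 3), y) ∈ ω)).card : ℝ) * E ω T 0 (G ω)
          ∂(bondPercolation (zdGraph 3) (criticalProbI 3)) =
        ∫ ω in percolatesAt (0 : Site 3),
          ((((zdGraph 3).neighborFinset (0 : Site 3)).filter
              (fun y => s((0 : Site 3), y) ∈ ω)).card : ℝ) *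
            E ω T 0 (fun l => G (BondConfig.relabel (sym2Equiv (Site.shift (-(l.getLastD 0)))) ω)
              ((l.reverse).map (fun z => z - l.getLastD 0)))
          ∂(bondPercolation (zdGraph 3) (criticalProbI 3)) := by
  intro E hE0 hEs T G hGm hGb
  exact setIntegral_card_mul_E_rev hE0 hEs T G hGm hGb

end Summit.CriticalPhenomena.PercolationContinuityZ3.Theorems.VerticalGamblersRuin
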